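import Mathlib
import Summits.NavierStokesRegularity.NavierStokesRegularity.Theorems.EulerZoomLiouvillePowerGaugeEulerLiouvilleWeakRenormalizedTransportMember
import HarnessLib

/-!
# Crux `EulerZoomLiouville.PowerGaugeEulerLiouville` (stmt-NavierStokesRegularity-19832), weak stratum `stub_selfSimilarWeakRest`,
# line `weak_lagrangian` (ns-idea-11 g9): THE BERNOULLI CLOCK OF A WEAK MEMBER — `stub_bernoulliClock` filled

Route №10 `EulerZoomLiouville` (NavierStokesRegularity), crux E = stmt-NavierStokesRegularity-19832; width seat ns-ezl-w1 g8 under the LEAD ns-typeII-p2 g14.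
The line `Cruxes/PowerGaugeEulerLiouville/Lines/weak_lagrangian.lean` factors the weak rest through a backward regular Lagrangian flow `Ψ` of `−W`
(`stub_backwardFlow`, M1), a Lagrangian chain rule for Sobolev observables (`stub_chainRule`, F2) and the BERNOULLI CLOCK: `ℋ` is non-decreasing along
a.e. backward orbit.  This file proves the clock from the chain rule, with the stub's reducible predicates δ-unfolded (the line fills
`stub_bernoulliClock` by `exact WeakLagrangian.bernoulliClock …`):

* the line's profile gradient `G` (`IsProfileGradient`) yields the weak pressure-gradient law (`WeakPressure.hasWeakFDerivOn_pressure`, profile equation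
  from `Past.profileData_of_past`) and hence the Lamb-form weak gradient `BG` of `ℋ = selfSimilarBernoulli γ 0 V P` (`WeakBernoulli.hasWeakFDerivOn_bernoulli`),
  `BG ∈ L^{3/2}_loc` (`WeakRenormalized.memLp_bernoulliGradient_threeHalves`);
* the chain rule along `Ψ` applied to `(ℋ, BG)` and the POINTWISE identity `BG(x)[W(x)] = (2γ−1)‖W(x)‖²` (`bernoulliGradient_apply_transport`) give
  `ℋ(Ψ_σ y) = ℋ(y) + (1−2γ)∫₀^σ ‖W(Ψ_s y)‖² ds ≥ ℋ(y)` for a.e. label (`bernoulli_backward_ge`);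
* two times `0 ≤ σ₁ ≤ σ₂`: the a.e. semigroup law `Ψ_{σ₂} = Ψ_{σ₂−σ₁} ∘ Ψ_{σ₁}` and the exact Jacobian law `(Ψ_{σ₁})_# vol = e^{3γσ₁} vol` transport the
  one-time statement to the label `Ψ_{σ₁} y` (`bernoulliClock`).

WHAT THIS IS NOT: not NS, not E, not M1/F2 — the clock is CONDITIONAL on the flow `Ψ` and the chain rule, both hypotheses here; 19832 is OPEN.
[folklore; ConstantinIgnatovaVicol2026Putative §3.4.3 (3.31); DiPernaLions1989 (the RLF setting)]
-/

noncomputable section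

-- flat `Theorems/<Route><Decl>…` files of one crux share the namespace of the crux (tree convention)
set_option linter.dupNamespace false

open MeasureTheory Set Filter Topology Metric Function TopologicalSpace ContinuousLinearMap
open scoped ENNReal NNReal InnerProductSpace RealInnerProductSpace ContDiff

namespace Summit.NavierStokesRegularity.NavierStokesRegularity.Theorems.PowerGaugeEulerLiouville.WeakLagrangian

open Literature.Analysis Literature.Analysis.FunctionSpaces Literature.Analysis.FluidPDE
open Summit.NavierStokesRegularity.NavierStokesRegularity.Theorems.PowerGaugeEulerLiouville

/-- The line's `bernoulliH ρ V P` is the tree's `selfSimilarBernoulli (1/(2+ρ)) 0 V P`. [folklore] -/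
theorem bernoulliH_eq (ρ : ℝ) (V : EuclideanSpace ℝ (Fin 3) → EuclideanSpace ℝ (Fin 3)) (P : EuclideanSpace ℝ (Fin 3) → ℝ) :
    (fun y => P y + (1 / 2) * ‖selfSimilarTransport (1 / (2 + ρ)) 0 V y‖ ^ 2 -
        (1 / 2) * ((1 / (2 + ρ)) * (1 - 1 / (2 + ρ))) * ‖y‖ ^ 2) =
      selfSimilarBernoulli (1 / (2 + ρ)) 0 V P := by
  funext y
  rw [selfSimilarBernoulli_apply, selfSimilarTransport_apply, sub_zero]
  ring

section Clock

variable {ρ : ℝ} {V : EuclideanSpace ℝ (Fin 3) → EuclideanSpace ℝ (Fin 3)} {P : EuclideanSpace ℝ (Fin 3) → ℝ}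
  {G : EuclideanSpace ℝ (Fin 3) → EuclideanSpace ℝ (Fin 3) →L[ℝ] EuclideanSpace ℝ (Fin 3)}
  {Ψ : ℝ → EuclideanSpace ℝ (Fin 3) → EuclideanSpace ℝ (Fin 3)}

/-- **ONE-TIME CLOCK: `ℋ(Ψ_σ y) ≥ ℋ(y)` for a.e. label.**  If `ℋ = selfSimilarBernoulli γ 0 V P` (`γ = 1/(2+ρ) ≤ ½`) has the Lamb-form weak gradient
`BG`, `BG ∈ L^{3/2}(B(0,r))` for all `r`, and the chain rule along `Ψ` holds for `(ℋ, BG)` at time `σ`, then for a.e. `y`: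
`ℋ(Ψ_σ y) = ℋ(y) + (1−2γ)∫₀^σ‖W(Ψ_s y)‖² ds ≥ ℋ(y)`. [folklore; ConstantinIgnatovaVicol2026Putative §3.4.3 (3.31)] -/
theorem bernoulli_backward_ge (hρ : 0 < ρ) {σ : ℝ} (hσ : 0 ≤ σ)
    (hCR : ∀ᵐ y ∂(volume : Measure (EuclideanSpace ℝ (Fin 3))),
      IntervalIntegrable (fun s =>
        ((2 * (1 / (2 + ρ)) - 1) • innerSL ℝ (selfSimilarTransport (1 / (2 + ρ)) 0 V (Ψ s y)) +
          (innerSL ℝ (selfSimilarTransport (1 / (2 + ρ)) 0 V (Ψ s y))).comp (G (Ψ s y)) -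
          innerSL ℝ (G (Ψ s y) (selfSimilarTransport (1 / (2 + ρ)) 0 V (Ψ s y))))
          (selfSimilarTransport (1 / (2 + ρ)) 0 V (Ψ s y))) volume 0 σ ∧
      selfSimilarBernoulli (1 / (2 + ρ)) 0 V P (Ψ σ y) = selfSimilarBernoulli (1 / (2 + ρ)) 0 V P y -
        ∫ s in (0 : ℝ)..σ, ((2 * (1 / (2 + ρ)) - 1) • innerSL ℝ (selfSimilarTransport (1 / (2 + ρ)) 0 V (Ψ s y)) +
          (innerSL ℝ (selfSimilarTransport (1 / (2 + ρ)) 0 V (Ψ s y))).comp (G (Ψ s y)) -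
          innerSL ℝ (G (Ψ s y) (selfSimilarTransport (1 / (2 + ρ)) 0 V (Ψ s y))))
          (selfSimilarTransport (1 / (2 + ρ)) 0 V (Ψ s y))) :
    ∀ᵐ y ∂(volume : Measure (EuclideanSpace ℝ (Fin 3))),
      selfSimilarBernoulli (1 / (2 + ρ)) 0 V P y ≤ selfSimilarBernoulli (1 / (2 + ρ)) 0 V P (Ψ σ y) := by
  have hγ : 2 * (1 / (2 + ρ)) - 1 ≤ 0 := by
    have h2 : (0 : ℝ) < 2 + ρ := by linarith
    rw [sub_nonpos, ← le_div_iff₀' two_pos, div_le_iff₀ h2]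
    linarith
  filter_upwards [hCR] with y hy
  obtain ⟨-, hy2⟩ := hy
  have hpt : ∀ s : ℝ,
      ((2 * (1 / (2 + ρ)) - 1) • innerSL ℝ (selfSimilarTransport (1 / (2 + ρ)) 0 V (Ψ s y)) +
          (innerSL ℝ (selfSimilarTransport (1 / (2 + ρ)) 0 V (Ψ s y))).comp (G (Ψ s y)) -
          innerSL ℝ (G (Ψ s y) (selfSimilarTransport (1 / (2 + ρ)) 0 V (Ψ s y))))
          (selfSimilarTransport (1 / (2 + ρ)) 0 V (Ψ s y)) =
        (2 * (1 / (2 + ρ)) - 1) * ‖selfSimilarTransport (1 / (2 + ρ)) 0 V (Ψ s y)‖ ^ 2 := fun s =>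
    WeakRenormalized.bernoulliGradient_apply_transport (V := V) (G := G) (1 / (2 + ρ)) (Ψ s y)
  simp_rw [hpt] at hy2
  have hneg : ∫ s in (0 : ℝ)..σ, (2 * (1 / (2 + ρ)) - 1) * ‖selfSimilarTransport (1 / (2 + ρ)) 0 V (Ψ s y)‖ ^ 2 ≤ 0 := by
    rw [intervalIntegral.integral_const_mul]
    exact mul_nonpos_of_nonpos_of_nonneg hγ (intervalIntegral.integral_nonneg hσ fun s _ => sq_nonneg _)
  linarith

/-- Transport of an a.e. statement to the label `Ψ_σ y` by the exact Jacobian law `(Ψ_σ)_# vol = e^{3γσ} vol`. [folklore] -/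
theorem ae_comp_of_jacobian {q : EuclideanSpace ℝ (Fin 3) → Prop} {σ : ℝ} (hΨm : Measurable (Function.uncurry Ψ))
    (hjac : Measure.map (Ψ σ) (volume : Measure (EuclideanSpace ℝ (Fin 3))) =
      ENNReal.ofReal (Real.exp (3 * (1 / (2 + ρ)) * σ)) • (volume : Measure (EuclideanSpace ℝ (Fin 3))))
    (h : ∀ᵐ z ∂(volume : Measure (EuclideanSpace ℝ (Fin 3))), q z) :
    ∀ᵐ y ∂(volume : Measure (EuclideanSpace ℝ (Fin 3))), q (Ψ σ y) := by
  have hmeas : Measurable (Ψ σ) := hΨm.of_uncurry_left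
  have h1 : ∀ᵐ z ∂(Measure.map (Ψ σ) (volume : Measure (EuclideanSpace ℝ (Fin 3)))), q z := by
    rw [hjac]
    exact Measure.ae_smul_measure h _
  exact ae_of_ae_map hmeas.aemeasurable h1

/-- **THE BERNOULLI CLOCK OF A WEAK MEMBER** (= `Sig.stub_bernoulliClock` of `Lines/weak_lagrangian.lean` with `InClass`, `IsExactlySelfSimilar`,
`IsProfileGradient`, `IsBackwardFlow`, `HasChainRule`, `HasBernoulliClock`, `bernoulliH`, `transportW` unfolded; `0 < ρ ≤ ½`).  For an exactly self-similar
member of the class with profile gradient `G`, a backward flow `Ψ` of `−W` with the exact Jacobian law, and the Lagrangian chain rule for Sobolev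
observables along `Ψ`: for all `0 ≤ σ₁ ≤ σ₂` and a.e. label `y`, `ℋ(Ψ_{σ₁} y) ≤ ℋ(Ψ_{σ₂} y)`. [folklore; ConstantinIgnatovaVicol2026Putative §3.4.3 (3.31)] -/
theorem bernoulliClock {ρ : ℝ} (hρ : 0 < ρ) (hρh : ρ ≤ 1 / 2)
    {u : ℝ → EuclideanSpace ℝ (Fin 3) → EuclideanSpace ℝ (Fin 3)} {p : ℝ → EuclideanSpace ℝ (Fin 3) → ℝ}
    {H : ℝ → EuclideanSpace ℝ (Fin 3) → EuclideanSpace ℝ (Fin 3) →L[ℝ] EuclideanSpace ℝ (Fin 3)} {c : ℝ≥0}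
    {V : EuclideanSpace ℝ (Fin 3) → EuclideanSpace ℝ (Fin 3)} {P : EuclideanSpace ℝ (Fin 3) → ℝ}
    {G : EuclideanSpace ℝ (Fin 3) → EuclideanSpace ℝ (Fin 3) →L[ℝ] EuclideanSpace ℝ (Fin 3)}
    {Ψ : ℝ → EuclideanSpace ℝ (Fin 3) → EuclideanSpace ℝ (Fin 3)}
    (hcls : IsSuitableWeakSolutionOn (slab (EuclideanSpace ℝ (Fin 3)) (Set.Iio 0) isOpen_Iio) 0 0 u p ∧
      HasWeakSpatialGradientOn (slab (EuclideanSpace ℝ (Fin 3)) (Set.Iio 0) isOpen_Iio) u H ∧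
      (∀ a : ℝ, 0 < a →
        ENNReal.ofReal (a ^ (2 * ρ)) * cknA a (0 : ℝ × EuclideanSpace ℝ (Fin 3)) u +
            ENNReal.ofReal (a ^ ρ) * cknE a (0 : ℝ × EuclideanSpace ℝ (Fin 3)) H +
          ENNReal.ofReal (a ^ (2 * ρ)) * cknD a (0 : ℝ × EuclideanSpace ℝ (Fin 3)) p ≤ (c : ℝ≥0∞)))
    (hss : (∀ τ : ℝ, τ < 0 → u τ = selfSimilarCollapse (1 / (2 + ρ)) 0 V τ) ∧
      (∀ τ : ℝ, τ < 0 → p τ = selfSimilarCollapsePressure (1 / (2 + ρ)) 0 P τ))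
    (hPG : HasWeakFDerivOn (⊤ : Opens (EuclideanSpace ℝ (Fin 3))) volume V G ∧
      (∀ r : ℝ, MemLp G 2 (volume.restrict (ball (0 : EuclideanSpace ℝ (Fin 3)) r))) ∧
      (∀ r : ℝ, MemLp V 6 (volume.restrict (ball (0 : EuclideanSpace ℝ (Fin 3)) r))) ∧
      HasWeakFDerivOn (⊤ : Opens (EuclideanSpace ℝ (Fin 3))) volume (selfSimilarTransport (1 / (2 + ρ)) 0 V)
        (fun x => (1 / (2 + ρ)) • ContinuousLinearMap.id ℝ (EuclideanSpace ℝ (Fin 3)) + G x))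
    (hΨ : Measurable (Function.uncurry Ψ) ∧
      (∀ y : EuclideanSpace ℝ (Fin 3), Ψ 0 y = y) ∧
      (∀ᵐ y ∂(volume : Measure (EuclideanSpace ℝ (Fin 3))), ∀ σ : ℝ, 0 ≤ σ →
        IntervalIntegrable (fun s => selfSimilarTransport (1 / (2 + ρ)) 0 V (Ψ s y)) volume 0 σ ∧
          Ψ σ y = y - ∫ s in (0 : ℝ)..σ, selfSimilarTransport (1 / (2 + ρ)) 0 V (Ψ s y)) ∧
      (∀ σ s : ℝ, 0 ≤ σ → 0 ≤ s → ∀ᵐ y ∂(volume : Measure (EuclideanSpace ℝ (Fin 3))), Ψ (σ + s) y = Ψ σ (Ψ s y)) ∧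
      (∀ σ : ℝ, 0 ≤ σ →
        Measure.map (Ψ σ) (volume : Measure (EuclideanSpace ℝ (Fin 3))) =
          ENNReal.ofReal (Real.exp (3 * (1 / (2 + ρ)) * σ)) • (volume : Measure (EuclideanSpace ℝ (Fin 3)))))
    (hCR : ∀ (f : EuclideanSpace ℝ (Fin 3) → ℝ) (g : EuclideanSpace ℝ (Fin 3) → EuclideanSpace ℝ (Fin 3) →L[ℝ] ℝ),
      HasWeakFDerivOn (⊤ : Opens (EuclideanSpace ℝ (Fin 3))) volume f g →
      (∀ r : ℝ, MemLp g (3 / 2 : ℝ≥0∞) (volume.restrict (ball (0 : EuclideanSpace ℝ (Fin 3)) r))) →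
      ∀ σ : ℝ, 0 ≤ σ → ∀ᵐ y ∂(volume : Measure (EuclideanSpace ℝ (Fin 3))),
        IntervalIntegrable (fun s => g (Ψ s y) (selfSimilarTransport (1 / (2 + ρ)) 0 V (Ψ s y))) volume 0 σ ∧
          f (Ψ σ y) = f y - ∫ s in (0 : ℝ)..σ, g (Ψ s y) (selfSimilarTransport (1 / (2 + ρ)) 0 V (Ψ s y))) :
    ∀ σ₁ σ₂ : ℝ, 0 ≤ σ₁ → σ₁ ≤ σ₂ → ∀ᵐ y ∂(volume : Measure (EuclideanSpace ℝ (Fin 3))),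
      (fun y => P y + (1 / 2) * ‖selfSimilarTransport (1 / (2 + ρ)) 0 V y‖ ^ 2 -
          (1 / 2) * ((1 / (2 + ρ)) * (1 - 1 / (2 + ρ))) * ‖y‖ ^ 2) (Ψ σ₁ y) ≤
        (fun y => P y + (1 / 2) * ‖selfSimilarTransport (1 / (2 + ρ)) 0 V y‖ ^ 2 -
          (1 / 2) * ((1 / (2 + ρ)) * (1 - 1 / (2 + ρ))) * ‖y‖ ^ 2) (Ψ σ₂ y) := by
  obtain ⟨hsw, hH, hgauge⟩ := hcls
  obtain ⟨hu, hp⟩ := hss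
  obtain ⟨hVG, hG2, hV6, -⟩ := hPG
  obtain ⟨hΨm, -, -, hsemi, hjac⟩ := hΨ
  -- ### the class data for the LINE's gradient `G`
  have hA : ∀ a : ℝ, 0 < a → ENNReal.ofReal (a ^ (2 * ρ)) *
      cknA a (0 : ℝ × EuclideanSpace ℝ (Fin 3)) u ≤ (c : ℝ≥0∞) :=
    fun a ha => le_trans (le_trans le_self_add le_self_add) (hgauge a ha)
  have hE : ∀ a : ℝ, 0 < a → ENNReal.ofReal (a ^ ρ) *
      cknE a (0 : ℝ × EuclideanSpace ℝ (Fin 3)) H ≤ (c : ℝ≥0∞) :=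
    fun a ha => le_trans (le_trans le_add_self le_self_add) (hgauge a ha)
  have hD : ∀ a : ℝ, 0 < a → ENNReal.ofReal (a ^ (2 * ρ)) *
      cknD a (0 : ℝ × EuclideanSpace ℝ (Fin 3)) p ≤ (c : ℝ≥0∞) :=
    fun a ha => le_trans le_add_self (hgauge a ha)
  have hu' : ∀ τ : ℝ, τ < 0 → u τ = fun x => selfSimilarCollapse (1 / (2 + ρ)) 0 V τ (x - 0) :=
    fun τ hτ => by rw [hu τ hτ]; funext x; rw [sub_zero]
  have hp' : ∀ τ : ℝ, τ < 0 → p τ = fun x => selfSimilarCollapsePressure (1 / (2 + ρ)) 0 P τ (x - 0) :=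
    fun τ hτ => by rw [hp τ hτ]; funext x; rw [sub_zero]
  obtain ⟨G', hVm, hPm, -, -, -, -, -, -, -, -, hP32, hdiv, heq, -, -⟩ :=
    Past.profileData_of_past hρ hρh le_rfl le_rfl 0 hsw.distributional hH hA hE hD hu' hp'
  -- ### Lamb gradient of `ℋ` for the line's `G`
  have hPgrad := WeakPressure.hasWeakFDerivOn_pressure (γ := 1 / (2 + ρ)) hVm hPm hV6 hVG hG2 hP32 hdiv heq
  have hHB := WeakBernoulli.hasWeakFDerivOn_bernoulli (γ := 1 / (2 + ρ)) hV6 hVG hG2 hPgrad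
  have hBGm : AEStronglyMeasurable (fun x => (2 * (1 / (2 + ρ)) - 1) • innerSL ℝ (selfSimilarTransport (1 / (2 + ρ)) 0 V x) +
      (innerSL ℝ (selfSimilarTransport (1 / (2 + ρ)) 0 V x)).comp (G x) -
      innerSL ℝ (G x (selfSimilarTransport (1 / (2 + ρ)) 0 V x))) volume := by
    have h := hHB.locallyIntegrableOn_deriv.aestronglyMeasurable
    simpa only [Opens.coe_top, Measure.restrict_univ] using h
  have hBG32 : ∀ r : ℝ, MemLp (fun x => (2 * (1 / (2 + ρ)) - 1) • innerSL ℝ (selfSimilarTransport (1 / (2 + ρ)) 0 V x) +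
      (innerSL ℝ (selfSimilarTransport (1 / (2 + ρ)) 0 V x)).comp (G x) -
      innerSL ℝ (G x (selfSimilarTransport (1 / (2 + ρ)) 0 V x))) (3 / 2 : ℝ≥0∞)
      (volume.restrict (ball (0 : EuclideanSpace ℝ (Fin 3)) r)) := fun r =>
    WeakRenormalized.memLp_bernoulliGradient_threeHalves (hV6 r) (hG2 r) hBGm.restrict
  -- ### the one-time clock at every `σ ≥ 0`
  have hone : ∀ σ : ℝ, 0 ≤ σ → ∀ᵐ y ∂(volume : Measure (EuclideanSpace ℝ (Fin 3))),
      selfSimilarBernoulli (1 / (2 + ρ)) 0 V P y ≤ selfSimilarBernoulli (1 / (2 + ρ)) 0 V P (Ψ σ y) := fun σ hσ =>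
    bernoulli_backward_ge (V := V) (P := P) (G := G) (Ψ := Ψ) hρ hσ (hCR _ _ hHB hBG32 σ hσ)
  -- ### two times
  intro σ₁ σ₂ hσ₁ hσ₁₂
  have hδ : 0 ≤ σ₂ - σ₁ := by linarith
  have h1 := ae_comp_of_jacobian (ρ := ρ) (Ψ := Ψ) (σ := σ₁) hΨm (hjac σ₁ hσ₁) (hone (σ₂ - σ₁) hδ)
  have h2 := hsemi (σ₂ - σ₁) σ₁ hδ hσ₁
  filter_upwards [h1, h2] with y hy1 hy2
  have e : σ₂ - σ₁ + σ₁ = σ₂ := by ring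
  rw [e] at hy2
  have e1 := congrFun (bernoulliH_eq ρ V P) (Ψ σ₁ y)
  have e2 := congrFun (bernoulliH_eq ρ V P) (Ψ σ₂ y)
  beta_reduce at e1 e2
  beta_reduce
  rw [e1, e2, hy2]
  exact hy1

end Clock

end Summit.NavierStokesRegularity.NavierStokesRegularity.Theorems.PowerGaugeEulerLiouville.WeakLagrangian

end
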